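import Summits.CriticalPhenomena.PercolationContinuityZ3.Theorems.PercNearOneGluingNoHeavyQuantFarTreeBlockCombSide
import Summits.CriticalPhenomena.PercolationContinuityZ3.Theorems.PercNearOneGluingNoHeavyQuantBlockCombSideMixture
import HarnessLib

/-!
# QUANT lane R8, FAR on trees beyond block-combs: FAR in gate coordinates for EVERY side structure with an x-ADMISSIBLE law
# (`Quant.BlockCombGate.farTree_blockComb_side_of_mixture`)

builds on p205010 (kernel theorem, internal audit signed; external expert review pending)

Support file (`--supports stmt-CriticalPhenomena-4575`), QUANT lane typer seat prim-quant-stmt (gen 16); lead g14's asks (lane INBOX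
2026-08-21T04:41Z (2), 04:55Z; LEAD-NOTES-G14 N25 addendum 2 / (6), conjecture (MIX-units)).  Theorems only (the `local notation3` of
`…QuantBlockCombMergeModel.lean`, verbatim), no definitions, no sorries, standard axioms.  Composition of the two typer tools of this generation:
the gate-side mixing identity `Quant.BlockCombGate.real_heavy_side_eq_sum` (`…QuantFarTreeBlockCombSide.lean`, p248816) and the canonical mixture
wrapper `Quant.BlockComb.tail_ge_of_mixture_law` (`…QuantBlockCombSideMixture.lean`).

* `Quant.BlockCombGate.farTree_blockComb_side_of_mixture` — **FAR AT EVERY LAYER, gate coordinates, for a block-comb plus ONE SIDE STRUCTURE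
  whose count law is x-admissible.**  Independent gates `q` on `E`; chain `ch` (injective); blobs `G k` (pairwise disjoint, off the chain), levels
  `lv k ≤ D`, sizes `a k`; a spare index `u` (`G u = ∅`, `a u = 0`) at the side level and a pool `B ∌ u` of spare indices at that level (`a = 0`
  on `B`); a side structure: gates `X` off the chain and the blobs, count `c : Set E → ℕ` local on `X` and `≤ N`, contributing `c ω` relays when
  the chain prefix of length `lv u` is open.  ADMISSIBILITY DATUM: components `r ∈ R` on the pool (weights `λ_r ≥ 0`, `Σ λ_r = 1`, sizes `s_r`,
  gates `γ_r ∈ [0,1]`, common mean `m̄`, at most `N` relays each) such that the side law equals the mixture law: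
  `Σ_{U ⊆ X : c U = h} w_X(U) = Σ_r λ_r · wt_{γ_r}^B{S ⊆ B : Σ_S s_r = h}` for `h ≤ N`.  HYPOTHESES OF THE ROW: mean
  `2j < Σ_k a k·marginal k + (∏_{i<lv u} q (ch i))·m̄`; cuts `1 − marginal ≤ t` for every live blob and for every live component blob
  (`1 − (∏_{i<lv u} q (ch i))·γ_r β ≤ t`); chain floor `1 − ∏_{i<D} q (ch i) ≤ t`.  CONCLUSION: `P(Σ_{k reached} a k + side count ≤ j) ≤ t`.
  The hair and the cherry (`…QuantFarTreeBlockCombHair.lean`, `…QuantFarTreeBlockCombCherry.lean`) are the instances with census-1 g13's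
  two-component data; (MIX-units) (gated stars of unit relays), once decomposed, plugs in here with no further measure theory.
* `Quant.BlockCombGate.farTree_blockComb_side_of_mixture_fun` — the same with the law identity in FUNCTIONAL form
  (`∀ F, Σ_{U ⊆ X} w_X(U)·F(c U) = Σ_r λ_r Σ_{S ⊆ B} wt_{γ_r}^B(S)·F(Σ_S s_r)`: no bound, no fibres; `ring` after powerset expansion).
[cite: KozmaNitzan2024, Conjecture 3 (p. 15)] (the gluing rows served); the theorem is [this work].
-/

noncomputable section

namespace Summit.CriticalPhenomena.PercolationContinuityZ3.Theorems

namespace Quant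

open Finset MeasureTheory
open Literature.Probability.LatticeModels
open Literature.Probability.Percolation
open scoped Classical

namespace BlockCombGate

variable {E : Type*} [Fintype E] [DecidableEq E] {κ : Type*} [Fintype κ] [DecidableEq κ]

/-- product weight of a set of open blobs (canonical model of `…QuantBlockCombMergeModel`) -/
local notation3 "wt[" g ", " S "]" => ∏ k, (if k ∈ (S : Finset κ) then (g : κ → ℝ) k else 1 - (g : κ → ℝ) k)
/-- depth law of the chain -/
local notation3 "pd[" D ", " q ", " i "]" =>
  (∏ i' ∈ Finset.range (i : ℕ), (q : ℕ → ℝ) i') * (if (i : ℕ) < (D : ℕ) then 1 - (q : ℕ → ℝ) i else 1)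
/-- mass counted at depth `i` -/
local notation3 "mass[" lv ", " a ", " i ", " S "]" =>
  ∑ k ∈ (S : Finset κ).filter (fun k => (lv : κ → ℕ) k ≤ (i : ℕ)), ((a : κ → ℕ) k : ℕ)
/-- the canonical tail -/
local notation3 "TAIL[" D ", " q ", " lv ", " a ", " g ", " j "]" =>
  ∑ i ∈ Finset.range ((D : ℕ) + 1), pd[D, q, i] *
    ∑ S : Finset κ, wt[g, S] * (if (j : ℕ) + 1 ≤ mass[lv, a, i, S] then (1 : ℝ) else 0)

/-! ### 1. FAR for a side structure with an admissible law -/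

/-- **FAR at every layer in gate coordinates for a block-comb plus one side structure whose count law is x-admissible** (see the file
header for the reading of every hypothesis).  Proof: complement; `real_heavy_side_eq_sum`; regroup by the side count
(`BlockComb.sum_mul_apply_eq_sum_fiber`); `BlockComb.tail_ge_of_mixture_law` with floor `x = 1 − t`. [this work] -/
theorem farTree_blockComb_side_of_mixture (q : E → unitInterval) (D : ℕ) (ch : Fin D → E) (hch : Function.Injective ch)
    (G : κ → Finset E) (hGdisj : ∀ k k', k ≠ k' → Disjoint (G k) (G k')) (hGch : ∀ k (i : Fin D), ch i ∉ G k)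
    (lv : κ → ℕ) (hlv : ∀ k, lv k ≤ D) (a : κ → ℕ) (j : ℕ) (t : ℝ)
    (u : κ) (hGu : G u = ∅) (hau : a u = 0)
    (B : Finset κ) (huB : u ∉ B) (hlvB : ∀ β ∈ B, lv β = lv u) (haB : ∀ β ∈ B, a β = 0)
    (X : Finset E) (hXch : ∀ i : Fin D, ch i ∉ X) (hXG : ∀ k, Disjoint X (G k))
    (c : Set E → ℕ) (hc : ∀ ω ω' : Set E, (∀ x ∈ X, (x ∈ ω ↔ x ∈ ω')) → c ω = c ω')
    (N : ℕ) (hcN : ∀ U ∈ X.powerset, c (U : Set E) ≤ N)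
    {ρ : Type*} (R : Finset ρ) (lam : ρ → ℝ) (hlam : ∀ r ∈ R, 0 ≤ lam r) (hlam1 : ∑ r ∈ R, lam r = 1)
    (s : ρ → κ → ℕ) (γ : ρ → κ → ℝ) (hγ : ∀ r ∈ R, ∀ β ∈ B, 0 ≤ γ r β ∧ γ r β ≤ 1)
    (hN : ∀ r ∈ R, ∑ β ∈ B, s r β ≤ N)
    (mbar : ℝ) (hmean : ∀ r ∈ R, ∑ β ∈ B, (s r β : ℝ) * γ r β = mbar)
    (hlaw : ∀ h, h ≤ N →
      ∑ U ∈ X.powerset.filter (fun U : Finset E => c (↑U : Set E) = h),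
          (∏ e ∈ X, (if e ∈ U then ((q e : unitInterval) : ℝ) else 1 - (q e : ℝ))) =
        ∑ r ∈ R, lam r *
          ∑ S ∈ B.powerset.filter (fun S => ∑ β ∈ S, s r β = h), ∏ β ∈ B, (if β ∈ S then γ r β else 1 - γ r β))
    (hbudget : (2 * j : ℝ) < ∑ k, (a k : ℝ) * ((∏ i ∈ Finset.range (lv k), (if h : i < D then ((q (ch ⟨i, h⟩) : unitInterval) : ℝ) else 1)) * ∏ e ∈ G k, (q e : ℝ)) + (∏ i ∈ Finset.range (lv u), (if h : i < D then ((q (ch ⟨i, h⟩) : unitInterval) : ℝ) else 1)) * mbar)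
    (ht : ∀ k, 0 < a k → 1 - (∏ i ∈ Finset.range (lv k), (if h : i < D then ((q (ch ⟨i, h⟩) : unitInterval) : ℝ) else 1)) * ∏ e ∈ G k, (q e : ℝ) ≤ t)
    (htB : ∀ r ∈ R, ∀ β ∈ B, 0 < s r β → 1 - (∏ i ∈ Finset.range (lv u), (if h : i < D then ((q (ch ⟨i, h⟩) : unitInterval) : ℝ) else 1)) * γ r β ≤ t)
    (htD : 1 - (∏ i ∈ Finset.range D, (if h : i < D then ((q (ch ⟨i, h⟩) : unitInterval) : ℝ) else 1)) ≤ t) :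
    (prodBernoulli q).real {ω : Set E | (∑ k ∈ Finset.univ.filter
        (fun k => (∀ i : Fin D, (i : ℕ) < lv k → ch i ∈ ω) ∧ ((G k : Finset E) : Set E) ⊆ ω), a k) +
        (if (∀ i : Fin D, (i : ℕ) < lv u → ch i ∈ ω) then c ω else 0) ≤ j} ≤ t := by
  -- trivial when `t ≥ 1`
  by_cases ht1 : 1 ≤ t
  · exact le_trans measureReal_le_one ht1
  push Not at ht1
  set H : Set (Set E) := {ω : Set E | j + 1 ≤ (∑ k ∈ Finset.univ.filter
        (fun k => (∀ i : Fin D, (i : ℕ) < lv k → ch i ∈ ω) ∧ ((G k : Finset E) : Set E) ⊆ ω), a k) +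
        (if (∀ i : Fin D, (i : ℕ) < lv u → ch i ∈ ω) then c ω else 0)} with hH
  have hcompl : {ω : Set E | (∑ k ∈ Finset.univ.filter
        (fun k => (∀ i : Fin D, (i : ℕ) < lv k → ch i ∈ ω) ∧ ((G k : Finset E) : Set E) ⊆ ω), a k) +
        (if (∀ i : Fin D, (i : ℕ) < lv u → ch i ∈ ω) then c ω else 0) ≤ j} = Hᶜ := by
    ext ω; simp only [hH, Set.mem_setOf_eq, Set.mem_compl_iff, not_le]; omega
  rw [hcompl, probReal_compl_eq_one_sub MeasurableSet.of_discrete,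
    real_heavy_side_eq_sum D q ch hch G hGdisj hGch lv hlv a j u hGu hau X hXch hXG c hc]
  -- the canonical side
  set qc : ℕ → ℝ := (fun i => if h : i < D then ((q (ch ⟨i, h⟩) : unitInterval) : ℝ) else 1) with hqc
  set g : κ → ℝ := fun k => ∏ e ∈ G k, (q e : ℝ) with hg
  have hqc01 : ∀ i, 0 ≤ qc i ∧ qc i ≤ 1 := fun i => by
    by_cases h : i < D
    · simp only [hqc, dif_pos h]; exact ⟨(q _).2.1, (q _).2.2⟩
    · simp only [hqc, dif_neg h]; norm_num
  have hg01 : ∀ k, 0 ≤ g k ∧ g k ≤ 1 := fun k =>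
    ⟨Finset.prod_nonneg fun e _ => (q e).2.1, Finset.prod_le_one (fun e _ => (q e).2.1) fun e _ => (q e).2.2⟩
  have hgu : g u = 1 := by simp only [hg, hGu, Finset.prod_empty]
  have hx : ∀ k, 0 < a k → 1 - t ≤ (∏ i ∈ Finset.range (lv k), qc i) * g k := fun k hk => by have := ht k hk; linarith
  have hxD : 1 - t ≤ ∏ i ∈ Finset.range D, qc i := by linarith
  have hxB : ∀ r ∈ R, ∀ β ∈ B, 0 < s r β → 1 - t ≤ (∏ i ∈ Finset.range (lv u), qc i) * γ r β :=
    fun r hr β hβ hs => by have := htB r hr β hβ hs; linarith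
  -- regroup the gate-side sum by the side count and apply the canonical wrapper
  rw [BlockComb.sum_mul_apply_eq_sum_fiber X.powerset
    (fun U => ∏ e ∈ X, (if e ∈ U then ((q e : unitInterval) : ℝ) else 1 - (q e : ℝ))) (fun U : Finset E => c (↑U : Set E))
    (fun h => TAIL[D, qc, lv, Function.update a u h, g, j]) N hcN]
  have key := BlockComb.tail_ge_of_mixture_law D qc hqc01 lv a g hg01 j (fun k _ => hlv k) u (hlv u) hau hgu B huB hlvB haB
    R lam hlam hlam1 s γ hγ (1 - t) (by linarith) hxD hx hxB mbar hmean hbudget N hN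
    (fun h => ∑ U ∈ X.powerset.filter (fun U : Finset E => c (↑U : Set E) = h),
      (∏ e ∈ X, (if e ∈ U then ((q e : unitInterval) : ℝ) else 1 - (q e : ℝ)))) hlaw
  linarith

/-! ### 2. The same with the law identity in functional form -/

/-- **FAR in gate coordinates for a side structure with an x-admissible law — FUNCTIONAL FORM of the law identity.**  As
`farTree_blockComb_side_of_mixture`, but admissibility is witnessed by the identity of mixed functionals
`Σ_{U ⊆ X} w_X(U)·F(c U) = Σ_r λ_r Σ_{S ⊆ B} wt_{γ_r}^B(S)·F(Σ_{β∈S} s_r β)` for EVERY `F : ℕ → ℝ` (no bound `N`, no fibres: for a concrete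
side structure both sides expand by `Finset.sum_powerset_insert` and the identity is `ring`, exactly as in census-1's `tail_ge_of_mean_hair`).
[this work] -/
theorem farTree_blockComb_side_of_mixture_fun (q : E → unitInterval) (D : ℕ) (ch : Fin D → E) (hch : Function.Injective ch)
    (G : κ → Finset E) (hGdisj : ∀ k k', k ≠ k' → Disjoint (G k) (G k')) (hGch : ∀ k (i : Fin D), ch i ∉ G k)
    (lv : κ → ℕ) (hlv : ∀ k, lv k ≤ D) (a : κ → ℕ) (j : ℕ) (t : ℝ)
    (u : κ) (hGu : G u = ∅) (hau : a u = 0)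
    (B : Finset κ) (huB : u ∉ B) (hlvB : ∀ β ∈ B, lv β = lv u) (haB : ∀ β ∈ B, a β = 0)
    (X : Finset E) (hXch : ∀ i : Fin D, ch i ∉ X) (hXG : ∀ k, Disjoint X (G k))
    (c : Set E → ℕ) (hc : ∀ ω ω' : Set E, (∀ x ∈ X, (x ∈ ω ↔ x ∈ ω')) → c ω = c ω')
    {ρ : Type*} (R : Finset ρ) (lam : ρ → ℝ) (hlam : ∀ r ∈ R, 0 ≤ lam r) (hlam1 : ∑ r ∈ R, lam r = 1)
    (s : ρ → κ → ℕ) (γ : ρ → κ → ℝ) (hγ : ∀ r ∈ R, ∀ β ∈ B, 0 ≤ γ r β ∧ γ r β ≤ 1)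
    (mbar : ℝ) (hmean : ∀ r ∈ R, ∑ β ∈ B, (s r β : ℝ) * γ r β = mbar)
    (hfun : ∀ F : ℕ → ℝ,
      ∑ U ∈ X.powerset, (∏ e ∈ X, (if e ∈ U then ((q e : unitInterval) : ℝ) else 1 - (q e : ℝ))) * F (c (U : Set E)) =
        ∑ r ∈ R, lam r *
          ∑ S ∈ B.powerset, (∏ β ∈ B, (if β ∈ S then γ r β else 1 - γ r β)) * F (∑ β ∈ S, s r β))
    (hbudget : (2 * j : ℝ) < ∑ k, (a k : ℝ) * ((∏ i ∈ Finset.range (lv k), (if h : i < D then ((q (ch ⟨i, h⟩) : unitInterval) : ℝ) else 1)) * ∏ e ∈ G k, (q e : ℝ)) + (∏ i ∈ Finset.range (lv u), (if h : i < D then ((q (ch ⟨i, h⟩) : unitInterval) : ℝ) else 1)) * mbar)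
    (ht : ∀ k, 0 < a k → 1 - (∏ i ∈ Finset.range (lv k), (if h : i < D then ((q (ch ⟨i, h⟩) : unitInterval) : ℝ) else 1)) * ∏ e ∈ G k, (q e : ℝ) ≤ t)
    (htB : ∀ r ∈ R, ∀ β ∈ B, 0 < s r β → 1 - (∏ i ∈ Finset.range (lv u), (if h : i < D then ((q (ch ⟨i, h⟩) : unitInterval) : ℝ) else 1)) * γ r β ≤ t)
    (htD : 1 - (∏ i ∈ Finset.range D, (if h : i < D then ((q (ch ⟨i, h⟩) : unitInterval) : ℝ) else 1)) ≤ t) :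
    (prodBernoulli q).real {ω : Set E | (∑ k ∈ Finset.univ.filter
        (fun k => (∀ i : Fin D, (i : ℕ) < lv k → ch i ∈ ω) ∧ ((G k : Finset E) : Set E) ⊆ ω), a k) +
        (if (∀ i : Fin D, (i : ℕ) < lv u → ch i ∈ ω) then c ω else 0) ≤ j} ≤ t := by
  -- trivial when `t ≥ 1`
  by_cases ht1 : 1 ≤ t
  · exact le_trans measureReal_le_one ht1
  push Not at ht1
  set H : Set (Set E) := {ω : Set E | j + 1 ≤ (∑ k ∈ Finset.univ.filter
        (fun k => (∀ i : Fin D, (i : ℕ) < lv k → ch i ∈ ω) ∧ ((G k : Finset E) : Set E) ⊆ ω), a k) +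
        (if (∀ i : Fin D, (i : ℕ) < lv u → ch i ∈ ω) then c ω else 0)} with hH
  have hcompl : {ω : Set E | (∑ k ∈ Finset.univ.filter
        (fun k => (∀ i : Fin D, (i : ℕ) < lv k → ch i ∈ ω) ∧ ((G k : Finset E) : Set E) ⊆ ω), a k) +
        (if (∀ i : Fin D, (i : ℕ) < lv u → ch i ∈ ω) then c ω else 0) ≤ j} = Hᶜ := by
    ext ω; simp only [hH, Set.mem_setOf_eq, Set.mem_compl_iff, not_le]; omega
  rw [hcompl, probReal_compl_eq_one_sub MeasurableSet.of_discrete,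
    real_heavy_side_eq_sum D q ch hch G hGdisj hGch lv hlv a j u hGu hau X hXch hXG c hc]
  -- the canonical side
  set qc : ℕ → ℝ := (fun i => if h : i < D then ((q (ch ⟨i, h⟩) : unitInterval) : ℝ) else 1) with hqc
  set g : κ → ℝ := fun k => ∏ e ∈ G k, (q e : ℝ) with hg
  have hqc01 : ∀ i, 0 ≤ qc i ∧ qc i ≤ 1 := fun i => by
    by_cases h : i < D
    · simp only [hqc, dif_pos h]; exact ⟨(q _).2.1, (q _).2.2⟩
    · simp only [hqc, dif_neg h]; norm_num
  have hg01 : ∀ k, 0 ≤ g k ∧ g k ≤ 1 := fun k =>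
    ⟨Finset.prod_nonneg fun e _ => (q e).2.1, Finset.prod_le_one (fun e _ => (q e).2.1) fun e _ => (q e).2.2⟩
  have hgu : g u = 1 := by simp only [hg, hGu, Finset.prod_empty]
  have hx : ∀ k, 0 < a k → 1 - t ≤ (∏ i ∈ Finset.range (lv k), qc i) * g k := fun k hk => by have := ht k hk; linarith
  have hxD : 1 - t ≤ ∏ i ∈ Finset.range D, qc i := by linarith
  have hxB : ∀ r ∈ R, ∀ β ∈ B, 0 < s r β → 1 - t ≤ (∏ i ∈ Finset.range (lv u), qc i) * γ r β :=
    fun r hr β hβ hs => by have := htB r hr β hβ hs; linarith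
  -- the functional identity with `F = TAIL[…, a[u ↦ ·], …]`, then the configuration-form wrapper
  rw [hfun (fun h => TAIL[D, qc, lv, Function.update a u h, g, j])]
  have key := BlockComb.tail_ge_of_mixture D qc hqc01 lv a g hg01 j (fun k _ => hlv k) u (hlv u) hau hgu B huB hlvB haB
    R lam hlam hlam1 s γ hγ (1 - t) (by linarith) hxD hx hxB mbar hmean hbudget
  linarith

end BlockCombGate

end Quant

end Summit.CriticalPhenomena.PercolationContinuityZ3.Theorems

end
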